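import Summits.AtomisticToContinuum.BoseEinsteinCondensation.Theses.BECConjugateDomination
import Summits.AtomisticToContinuum.BoseEinsteinCondensation.Theorems.BECInsertionCorrectorStaticResponseBoundTruncationCompactness
import Literature.MathematicalPhysics.QuantumManyBody.CondensateOccupationStability
import HarnessLib

/-!
# Truncation compactness at fixed volume: stub `stub_truncationCompactness` (S7a) of line
# `third-law-current-floor` for crux `BECConjugateDomination.HardCoreExtension` (stmt-AtomisticToContinuum-11786)
# — the provable branches and the reduction to ONE missing fact

S7a: at FIXED `(N, L)`, if every truncation `vₙ = min(v, n)` of an admissible `v` with `E₀(v) < ⊤` has a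
positive real exact minimiser `Ψₙ` with `n₀(Ψₙ) ≥ cN`, then at every slack `δ' > 0` and for every `ε' > 0`
some `δ'`-near-minimiser `Φ` of `v` (periodic `C¹` Bose class) has `n₀(Φ) ≥ (c - ε')N`. Proved here
(sorry-free, no new definitions): the degenerate branches `(c - ε')N ≤ 0` (covers `N = 0`), `1 < c` (vacuous),
BOUNDED `v` (`vₙ = v` eventually); `exists_limitProfile_of_seq` — **the compactness half with memory of the
subsequence** (Rellich + Fatou + Beppo Levi through the FREE form domain of `PeriodicFormDomain.lean`, as in the
sibling file `…StaticResponseBoundTruncationCompactness.lean`): trial states with `E_{vₙ}[Ψₙ] ≤ B < ⊤` have a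
subsequence whose embedded `L²((ℝ/ℤ)^{3N})` classes converge to a unit Bose-symmetric `η` of maximal-form
energy `∑ₖ (2πk/L)²|⟪eₖ, η⟫|² + ∫ (W ∘ fromUnitTorusN)|η|² ≤ B` (`W = ∑_{i<j} v^per(xᵢ - xⱼ)`, hard cores
included); `norm_formEmbed_sub_sq_trialState` (the embedding is isometric on differences); and
`stub_truncationCompactness_of_maxFormApproximation` — **the reduction**: S7a (verbatim) follows from the one
classical fact spelled out as its hypothesis `hcore` ("MaxFormApproximation": a unit Bose-symmetric `η` of
finite maximal-form energy is an `L²`-limit of `C¹` periodic Bose trial states whose `v`-energies are at most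
that energy in the limit — the `C¹` core is a form core of the MAXIMAL hard-core form; it implies the sibling
cruxes' registered, unproved `stub_maxFormBound`), via the `2N‖·‖₂`-Lipschitz continuity of `n₀`.
Why S7a itself is not closed: `hcore` needs quasi-continuous representatives of `H¹` classes, Newtonian
capacity (Wiener's criterion), Hedberg's synthesis theorem and the Kato–Simon form-core theorem for `L¹_loc`
potentials — none in Mathlib or the tree. References: B. Simon, *J. Funct. Anal.* 28 (1978) 377 and
*J. Operator Theory* 1 (1979) 37; [ReedSimonIV1978] Thm XIII.64; Adams–Hedberg (1996) Thm 9.1.3; [LSSY2005] App. A.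
-/

noncomputable section

namespace Summit.AtomisticToContinuum.BoseEinsteinCondensation.Cruxes.HardCoreExtension.ThirdLawCurrentFloor

open MeasureTheory Filter UnitAddTorus
open scoped ENNReal NNReal BigOperators Topology InnerProductSpace
open Literature.MathematicalPhysics.QuantumManyBody.BoseGas
open Summit.AtomisticToContinuum.BoseEinsteinCondensation.Cruxes.StaticResponseBound.UvThomsonForceWave

-- The measure on `ℝ/ℤ` is the Haar PROBABILITY measure, as in `PeriodicFormDomain.lean`.
attribute [local instance] Literature.MathematicalPhysics.QuantumManyBody.BoseGas.formDomain_measureSpace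
  Literature.MathematicalPhysics.QuantumManyBody.BoseGas.formDomain_isProbabilityMeasure
  Literature.MathematicalPhysics.QuantumManyBody.BoseGas.formDomain_isProbabilityMeasure_pi

/-- Local notation for the Hilbert space `L²((ℝ/ℤ)^{3N})`, as in `PeriodicFormDomain.lean`. [folklore] -/
local notation "L2T " N':max => Lp ℂ 2 (volume : Measure (UnitAddTorus (Fin N' × Fin 3)))

section Branches

variable {N : ℕ} {L : ℝ}

/-- At every positive slack a finite infimum has a near-minimiser. [folklore] -/
theorem exists_periodicEnergy_le_add (v : ℝ → ℝ≥0∞) (hE : periodicGroundStateEnergy v N L ≠ ⊤)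
    {δ : ℝ≥0∞} (hδ : 0 < δ) :
    ∃ Φ : PeriodicTrialState N L, periodicEnergy v Φ ≤ periodicGroundStateEnergy v N L + δ := by
  obtain ⟨Φ, hΦ⟩ := iInf_lt_iff.1 (ENNReal.lt_add_right hE hδ.ne')
  exact ⟨Φ, hΦ.le⟩

/-- **Branch `(c - ε')N ≤ 0`** (in particular `N = 0`, or `c ≤ ε'`): the occupation floor is `0` and any
near-minimiser of `v` will do. [folklore] -/
theorem truncationCompactness_of_nonpos (v : ℝ → ℝ≥0∞) (hE : periodicGroundStateEnergy v N L ≠ ⊤)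
    {c ε' : ℝ} (h : (c - ε') * N ≤ 0) {δ' : ℝ≥0∞} (hδ' : 0 < δ') :
    ∃ Φ : PeriodicTrialState N L, periodicEnergy v Φ ≤ periodicGroundStateEnergy v N L + δ' ∧
      ENNReal.ofReal ((c - ε') * N) ≤ condensateOccupation N L Φ.ψ := by
  obtain ⟨Φ, hΦ⟩ := exists_periodicEnergy_le_add v hE hδ'
  exact ⟨Φ, hΦ, by rw [ENNReal.ofReal_of_nonpos h]; exact bot_le⟩

/-- **Branch `1 < c` is vacuous**: a trial state with `ofReal (cN) ≤ n₀` on `N ≥ 1` particles has `c ≤ 1`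
(`n₀ ≤ N‖Ψ‖² = N`), so the truncation hypothesis of S7a (at any height) forces `c ≤ 1` unless `N = 0`.
[cite: LSSY2005, App. A (A.11)] -/
theorem fraction_le_one_of_ofReal_le_condensateOccupation (hL : 0 < L) (hN : 0 < N) {c : ℝ}
    (Ψ : PeriodicTrialState N L) (h : ENNReal.ofReal (c * N) ≤ condensateOccupation N L Ψ.ψ) : c ≤ 1 := by
  have hle : condensateOccupation N L Ψ.ψ ≤ (N : ℝ≥0∞) := by
    have h1 := condensateOccupation_le_card_mul_lintegral hL Ψ.contDiff.continuous (L := L)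
    rwa [Ψ.norm_eq, mul_one] at h1
  have h' : ENNReal.ofReal (c * N) ≤ ENNReal.ofReal (N : ℝ) := by
    rw [ENNReal.ofReal_natCast]
    exact h.trans hle
  have hN' : (0 : ℝ) < N := Nat.cast_pos.2 hN
  have := (ENNReal.ofReal_le_ofReal_iff hN'.le).1 h'
  nlinarith

/-- **Branch: BOUNDED `v`** (S7a verbatim plus `∃ M ≠ ⊤, v ≤ M`). The truncation at height `n ≥ M` is `v`
itself, so its minimiser `Ψₙ` is a minimiser of `v` with `n₀ ≥ cN ≥ (c - ε')N`. [folklore] -/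
theorem truncationCompactness_of_bounded (v : ℝ → ℝ≥0∞) (hbdd : ∃ M : ℝ≥0∞, M ≠ ⊤ ∧ ∀ r, v r ≤ M)
    (N : ℕ) (L : ℝ) (c : ℝ)
    (hmin : ∀ n : ℕ, ∃ Ψ : PeriodicTrialState N L,
        periodicEnergy (fun r => min (v r) (n : ℝ≥0∞)) Ψ =
          periodicGroundStateEnergy (fun r => min (v r) (n : ℝ≥0∞)) N L ∧
        ENNReal.ofReal (c * N) ≤ condensateOccupation N L Ψ.ψ)
    {ε' : ℝ} (hε' : 0 < ε') (δ' : ℝ≥0∞) :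
    ∃ Φ : PeriodicTrialState N L, periodicEnergy v Φ ≤ periodicGroundStateEnergy v N L + δ' ∧
      ENNReal.ofReal ((c - ε') * N) ≤ condensateOccupation N L Φ.ψ := by
  obtain ⟨M, hM, hvM⟩ := hbdd
  obtain ⟨n, hn⟩ := ENNReal.exists_nat_gt hM
  have hv : (fun r => min (v r) (n : ℝ≥0∞)) = v := funext fun r => min_eq_left ((hvM r).trans hn.le)
  obtain ⟨Ψ, hΨmin, hΨocc⟩ := hmin n
  rw [hv] at hΨmin
  refine ⟨Ψ, hΨmin.le.trans le_self_add, (ENNReal.ofReal_le_ofReal ?_).trans hΨocc⟩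
  nlinarith [show (0 : ℝ) ≤ ε' * N by positivity]

end Branches

section LimitProfile

variable {N : ℕ} {L : ℝ} {v : ℝ → ℝ≥0∞}

/-- **Compactness with memory (Rellich + Fatou + Beppo Levi).** For `L > 0`, measurable `v` and trial states
`Ψₙ` with `E_{min(v,n)}[Ψₙ] ≤ B < ⊤`, along a subsequence the embedded classes `ι(graphEmbed Ψₙ)` (free form
domain) converge in `L²((ℝ/ℤ)^{3N})` to a unit `η`, Bose-symmetric in momentum space, whose MAXIMAL-form
energy for the full `v` (hard cores allowed) is at most `B`. [cite: ReedSimonIV1978, Thm. XIII.64] -/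
theorem exists_limitProfile_of_seq (hv : Measurable v) (hL : 0 < L) {B : ℝ≥0∞} (hB : B ≠ ⊤)
    (Ψ : ℕ → PeriodicTrialState N L) (hΨ : ∀ n, periodicEnergy (truncPotential v n) (Ψ n) ≤ B) :
    ∃ (η : L2T N) (φ : ℕ → ℕ), StrictMono φ ∧
      Tendsto (fun i => formEmbed hL measurable_zeroProfile (lintegral_periodicInteraction_zero_ne_top N L)
        ⟨graphEmbed hL measurable_zeroProfile (lintegral_periodicInteraction_zero_ne_top N L)
          ⟨(Ψ (φ i)).ψ, (Ψ (φ i)).mem_periodicCore⟩, graphEmbed_mem_formDomain _ _ _ _⟩) atTop (𝓝 η) ∧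
      ‖η‖ = 1 ∧
      (∀ (σ : Equiv.Perm (Fin N)) (n : Fin N × Fin 3 → ℤ),
        ⟪(mFourierLp 2 (fun p : Fin N × Fin 3 => n (σ p.1, p.2)) : L2T N), η⟫_ℂ =
          ⟪(mFourierLp 2 n : L2T N), η⟫_ℂ) ∧
      ∑' n : Fin N × Fin 3 → ℤ, ENNReal.ofReal (∑ p, (2 * Real.pi * (n p : ℝ) / L) ^ 2) *
          (‖⟪(mFourierLp 2 n : L2T N), η⟫_ℂ‖₊ : ℝ≥0∞) ^ 2 +
        ∫⁻ t, periodicInteraction v L (fromUnitTorusN L t) *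
          (‖(η : UnitAddTorus (Fin N × Fin 3) → ℂ) t‖₊ : ℝ≥0∞) ^ 2 ≤ B := by
  -- the FREE form domain as a compactness device
  set g : ℕ → formDomain hL measurable_zeroProfile (lintegral_periodicInteraction_zero_ne_top N L) :=
    fun n => ⟨graphEmbed hL measurable_zeroProfile (lintegral_periodicInteraction_zero_ne_top N L)
      ⟨(Ψ n).ψ, (Ψ n).mem_periodicCore⟩, graphEmbed_mem_formDomain _ _ _ _⟩ with hg
  set f : ℕ → L2T N := fun n =>
    formEmbed hL measurable_zeroProfile (lintegral_periodicInteraction_zero_ne_top N L) (g n) with hf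
  have hf1 : ∀ n, ‖f n‖ = 1 := fun n =>
    norm_formEmbed_graphEmbed_trialState hL measurable_zeroProfile
      (lintegral_periodicInteraction_zero_ne_top N L) (Ψ n)
  have hkin_le : ∀ n, ∫⁻ X in cellN N L, kineticDensity (Ψ n).ψ X ≤ B := fun n =>
    (lintegral_kineticDensity_le_periodicEnergy _ (Ψ n)).trans (hΨ n)
  have hgn : ∀ n, ‖g n‖ ^ 2 ≤ 1 + B.toReal := fun n => by
    have h1 : ‖g n‖ = ‖graphEmbed hL measurable_zeroProfile (lintegral_periodicInteraction_zero_ne_top N L)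
        ⟨(Ψ n).ψ, (Ψ n).mem_periodicCore⟩‖ := rfl
    rw [h1, norm_graphEmbed_sq_trialState, periodicEnergy_zero_eq]
    linarith [ENNReal.toReal_mono hB (hkin_le n)]
  -- Rellich: an `L²`-convergent subsequence of the embedded states
  set R : ℝ := Real.sqrt (1 + B.toReal) + 1 with hR
  have hball : ∀ n, g n ∈ Metric.ball (0 : formDomain hL measurable_zeroProfile
      (lintegral_periodicInteraction_zero_ne_top N L)) R := fun n => by
    rw [Metric.mem_ball, dist_zero_right]
    have h := Real.abs_le_sqrt (hgn n)
    rw [abs_of_nonneg (norm_nonneg _)] at h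
    linarith
  have hK : IsCompact (closure ((formEmbed hL measurable_zeroProfile
      (lintegral_periodicInteraction_zero_ne_top N L)) '' Metric.ball 0 R)) :=
    (isCompactOperator_formEmbed hL measurable_zeroProfile
      (lintegral_periodicInteraction_zero_ne_top N L)).isCompact_closure_image_ball
      (f := (formEmbed hL measurable_zeroProfile (lintegral_periodicInteraction_zero_ne_top N L) :
        formDomain hL measurable_zeroProfile (lintegral_periodicInteraction_zero_ne_top N L) →ₗ[ℂ] L2T N)) R
  obtain ⟨η, -, φ, hφ, hconv⟩ := hK.tendsto_subseq (x := f) fun n => subset_closure ⟨g n, hball n, rfl⟩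
  -- an a.e.-convergent further subsequence
  obtain ⟨ns, hns, hae⟩ := (tendstoInMeasure_of_tendsto_Lp hconv).exists_seq_tendsto_ae
  set ψ : ℕ → ℕ := φ ∘ ns with hψdef
  have hψ : StrictMono ψ := hφ.comp hns
  have hconvψ : Tendsto (fun i => f (ψ i)) atTop (𝓝 η) := hconv.comp hns.tendsto_atTop
  refine ⟨η, ψ, hψ, hconvψ, ?_, ?_, ?_⟩
  · -- `‖η‖ = 1`
    have h1 : Tendsto (fun i => ‖f (ψ i)‖) atTop (𝓝 ‖η‖) := (continuous_norm.tendsto η).comp hconvψ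
    simp only [hf1] at h1
    exact tendsto_nhds_unique h1 tendsto_const_nhds
  · -- Bose symmetry in momentum space passes to the limit
    intro σ n
    have hc : ∀ m : Fin N × Fin 3 → ℤ, Continuous fun x : L2T N => ⟪(mFourierLp 2 m : L2T N), x⟫_ℂ :=
      fun m => continuous_const.inner continuous_id
    have h1 := ((hc (fun p : Fin N × Fin 3 => n (σ p.1, p.2))).tendsto η).comp hconvψ
    have h2 := ((hc n).tendsto η).comp hconvψ
    have h12 : (fun x : L2T N => ⟪(mFourierLp 2 (fun p : Fin N × Fin 3 => n (σ p.1, p.2)) : L2T N), x⟫_ℂ) ∘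
          (fun i => f (ψ i)) =
        (fun x : L2T N => ⟪(mFourierLp 2 n : L2T N), x⟫_ℂ) ∘ (fun i => f (ψ i)) := by
      funext i
      simp only [Function.comp_apply, hf]
      rw [inner_mFourierLp_formEmbed_trialState, inner_mFourierLp_formEmbed_trialState,
        configFourierCoeff_perm (Ψ (ψ i)).symm]
    rw [h12] at h1
    exact tendsto_nhds_unique h1 h2
  · -- the energy bound, first at each truncation height `m`
    have hm : ∀ m : ℕ,
        ∑' n : Fin N × Fin 3 → ℤ, ENNReal.ofReal (∑ p, (2 * Real.pi * (n p : ℝ) / L) ^ 2) *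
            (‖⟪(mFourierLp 2 n : L2T N), η⟫_ℂ‖₊ : ℝ≥0∞) ^ 2 +
          ∫⁻ t, periodicInteraction (truncPotential v m) L (fromUnitTorusN L t) *
            (‖(η : UnitAddTorus (Fin N × Fin 3) → ℂ) t‖₊ : ℝ≥0∞) ^ 2 ≤ B := by
      intro m
      have hWm : Measurable (periodicInteraction (N := N) (truncPotential v m) L) :=
        measurable_periodicInteraction_trunc (measurable_truncPotential hv m) L
      -- lower semicontinuity of the kinetic energy
      have hkin : ∑' n : Fin N × Fin 3 → ℤ, ENNReal.ofReal (∑ p, (2 * Real.pi * (n p : ℝ) / L) ^ 2) *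
            (‖⟪(mFourierLp 2 n : L2T N), η⟫_ℂ‖₊ : ℝ≥0∞) ^ 2 ≤
          liminf (fun i => ∫⁻ X in cellN N L, kineticDensity (Ψ (ψ i)).ψ X) atTop := by
        have h := tsum_mul_inner_sq_le_liminf (fun n : Fin N × Fin 3 → ℤ => (mFourierLp 2 n : L2T N))
          (w := fun n : Fin N × Fin 3 → ℤ => ENNReal.ofReal (∑ p, (2 * Real.pi * (n p : ℝ) / L) ^ 2))
          (fun _ => ENNReal.ofReal_ne_top) hconvψ
        refine h.trans_eq ?_
        congr 1
        funext i
        exact tsum_kinetic_formEmbed_trialState hL (Ψ (ψ i))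
      -- Fatou for the (bounded-height) potential energy
      have hpot : ∫⁻ t, periodicInteraction (truncPotential v m) L (fromUnitTorusN L t) *
            (‖(η : UnitAddTorus (Fin N × Fin 3) → ℂ) t‖₊ : ℝ≥0∞) ^ 2 ≤
          liminf (fun i => ∫⁻ X in cellN N L, periodicInteraction (truncPotential v m) L X *
            (‖(Ψ (ψ i)).ψ X‖₊ : ℝ≥0∞) ^ 2) atTop := by
        calc ∫⁻ t, periodicInteraction (truncPotential v m) L (fromUnitTorusN L t) *
              (‖(η : UnitAddTorus (Fin N × Fin 3) → ℂ) t‖₊ : ℝ≥0∞) ^ 2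
            ≤ ∫⁻ t, liminf (fun i => periodicInteraction (truncPotential v m) L (fromUnitTorusN L t) *
                (‖(f (ψ i) : UnitAddTorus (Fin N × Fin 3) → ℂ) t‖₊ : ℝ≥0∞) ^ 2) atTop := by
              refine lintegral_mono_ae (hae.mono fun t ht => ?_)
              have hsq : Tendsto (fun i => (‖(f (ψ i) : UnitAddTorus (Fin N × Fin 3) → ℂ) t‖₊ : ℝ≥0∞) ^ 2)
                  atTop (𝓝 ((‖(η : UnitAddTorus (Fin N × Fin 3) → ℂ) t‖₊ : ℝ≥0∞) ^ 2)) :=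
                ((ENNReal.continuous_pow 2).tendsto _).comp
                  ((ENNReal.continuous_coe.tendsto _).comp ht.nnnorm)
              rw [← hsq.liminf_eq]
              exact mul_liminf_le _ _
          _ ≤ liminf (fun i => ∫⁻ t, periodicInteraction (truncPotential v m) L (fromUnitTorusN L t) *
                (‖(f (ψ i) : UnitAddTorus (Fin N × Fin 3) → ℂ) t‖₊ : ℝ≥0∞) ^ 2) atTop :=
              lintegral_liminf_le' fun i => ((hWm.comp (measurable_fromUnitTorusN L)).aemeasurable.mul
                ((Lp.aestronglyMeasurable (f (ψ i))).aemeasurable.nnnorm.coe_nnreal_ennreal.pow_const 2))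
          _ = liminf (fun i => ∫⁻ X in cellN N L, periodicInteraction (truncPotential v m) L X *
                (‖(Ψ (ψ i)).ψ X‖₊ : ℝ≥0∞) ^ 2) atTop := by
              congr 1
              funext i
              exact lintegral_pot_formEmbed_trialState hL (Ψ (ψ i)) hWm
      -- combine and use the energy bound along `ψ i ≥ m`
      set KINi : ℕ → ℝ≥0∞ := fun i => ∫⁻ X in cellN N L, kineticDensity (Ψ (ψ i)).ψ X with hKINi
      set POTi : ℕ → ℝ≥0∞ := fun i => ∫⁻ X in cellN N L, periodicInteraction (truncPotential v m) L X *
          (‖(Ψ (ψ i)).ψ X‖₊ : ℝ≥0∞) ^ 2 with hPOTi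
      have hsum : ∀ i, KINi i + POTi i = periodicEnergy (truncPotential v m) (Ψ (ψ i)) := fun i => by
        simp only [hKINi, hPOTi, periodicEnergy]
        rw [← lintegral_add_left (measurable_kineticDensity_any (Ψ (ψ i)).ψ)]
      have hev : ∀ᶠ i in atTop, KINi i + POTi i ≤ B := by
        filter_upwards [hψ.tendsto_atTop.eventually (eventually_ge_atTop m)] with i hi
        rw [hsum i]
        exact (monotone_periodicEnergy_truncPotential v (Ψ (ψ i)) hi).trans (hΨ (ψ i))
      calc _ ≤ liminf KINi atTop + liminf POTi atTop := add_le_add hkin hpot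
        _ ≤ liminf (fun i => KINi i + POTi i) atTop := liminf_add_liminf_le KINi POTi
        _ ≤ liminf (fun _ : ℕ => B) atTop := liminf_le_liminf hev
        _ = B := liminf_const B
    -- Beppo Levi in the truncation height
    have hmeas_m : ∀ m, AEMeasurable (fun t => periodicInteraction (truncPotential v m) L (fromUnitTorusN L t) *
        (‖(η : UnitAddTorus (Fin N × Fin 3) → ℂ) t‖₊ : ℝ≥0∞) ^ 2) volume := fun m =>
      ((measurable_periodicInteraction_trunc (measurable_truncPotential hv m) L).comp
        (measurable_fromUnitTorusN L)).aemeasurable.mul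
        ((Lp.aestronglyMeasurable η).aemeasurable.nnnorm.coe_nnreal_ennreal.pow_const 2)
    have hsup : ∫⁻ t, periodicInteraction v L (fromUnitTorusN L t) *
          (‖(η : UnitAddTorus (Fin N × Fin 3) → ℂ) t‖₊ : ℝ≥0∞) ^ 2 =
        ⨆ m, ∫⁻ t, periodicInteraction (truncPotential v m) L (fromUnitTorusN L t) *
          (‖(η : UnitAddTorus (Fin N × Fin 3) → ℂ) t‖₊ : ℝ≥0∞) ^ 2 := by
      rw [← lintegral_iSup' hmeas_m (Eventually.of_forall fun t => fun m m' h => by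
        dsimp only
        gcongr
        exact monotone_periodicInteraction_truncPotential v L _ h)]
      refine lintegral_congr fun t => ?_
      rw [← ENNReal.iSup_mul, iSup_periodicInteraction_truncPotential]
    rw [hsup, ENNReal.add_iSup]
    exact iSup_le hm

/-- **The embedding is isometric on differences of trial states**:
`‖ι(graphEmbed Φ) - ι(graphEmbed Ψ)‖² = ∫_{[0,L)^{3N}} ‖Φ - Ψ‖₊²` (free form domain). [folklore] -/
theorem norm_formEmbed_sub_sq_trialState (hL : 0 < L) (Φ Ψ : PeriodicTrialState N L) :
    ‖formEmbed hL measurable_zeroProfile (lintegral_periodicInteraction_zero_ne_top N L)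
        ⟨graphEmbed hL measurable_zeroProfile (lintegral_periodicInteraction_zero_ne_top N L)
          ⟨Φ.ψ, Φ.mem_periodicCore⟩, graphEmbed_mem_formDomain _ _ _ _⟩ -
      formEmbed hL measurable_zeroProfile (lintegral_periodicInteraction_zero_ne_top N L)
        ⟨graphEmbed hL measurable_zeroProfile (lintegral_periodicInteraction_zero_ne_top N L)
          ⟨Ψ.ψ, Ψ.mem_periodicCore⟩, graphEmbed_mem_formDomain _ _ _ _⟩‖ ^ 2 =
      (∫⁻ X in cellN N L, (‖Φ.ψ X - Ψ.ψ X‖₊ : ℝ≥0∞) ^ 2).toReal := by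
  set a : periodicCore N L := ⟨Φ.ψ, Φ.mem_periodicCore⟩ with ha
  set b : periodicCore N L := ⟨Ψ.ψ, Ψ.mem_periodicCore⟩ with hb
  have hsub : formEmbed hL measurable_zeroProfile (lintegral_periodicInteraction_zero_ne_top N L)
        ⟨graphEmbed hL measurable_zeroProfile (lintegral_periodicInteraction_zero_ne_top N L) a,
          graphEmbed_mem_formDomain _ _ _ _⟩ -
      formEmbed hL measurable_zeroProfile (lintegral_periodicInteraction_zero_ne_top N L)
        ⟨graphEmbed hL measurable_zeroProfile (lintegral_periodicInteraction_zero_ne_top N L) b,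
          graphEmbed_mem_formDomain _ _ _ _⟩ =
      formEmbed hL measurable_zeroProfile (lintegral_periodicInteraction_zero_ne_top N L)
        ⟨graphEmbed hL measurable_zeroProfile (lintegral_periodicInteraction_zero_ne_top N L) (a - b),
          graphEmbed_mem_formDomain _ _ _ _⟩ := by
    rw [← map_sub]
    congr 1
    apply Subtype.ext
    simp only [Submodule.coe_sub, map_sub]
  rw [hsub, norm_formEmbed_graphEmbed_sq]
  rfl

end LimitProfile

section Reduction

/-- **S7a from ONE missing fact ("MaxFormApproximation", the hypothesis `hcore`).** Suppose that for every
admissible `v`, every `N`, `L > 0`, every unit `η ∈ L²((ℝ/ℤ)^{3N})` that is Bose-symmetric in momentum space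
with finite maximal-form energy `Q_v(η) = ∑ₖ (2πk/L)²|⟪eₖ, η⟫|² + ∫ (W ∘ fromUnitTorusN)|η|²`, and every
`ε > 0`, some periodic `C¹` Bose trial state `Φ` has `E_v[Φ] ≤ Q_v(η) + ε` and `‖ι(graphEmbed Φ) - η‖ ≤ ε`.
Then S7a holds: `E_{vₙ}[Ψₙ] = E₀(vₙ) ≤ E₀(v) < ⊤`, so (`exists_limitProfile_of_seq`) a subsequence converges in
`L²` to a unit Bose-symmetric `η` with `Q_v(η) ≤ E₀(v)`; the approximant `Φ` of `η` at scale
`ε = min(δ' ∧ 1, ε'/4)` is a `δ'`-near-minimiser of `v`, `2ε`-close in `L²(cell^N)` to some `Ψₙ`, and the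
`2N‖·‖₂`-Lipschitz bound for `n₀` turns `n₀(Ψₙ) ≥ cN` into `n₀(Φ) ≥ (c - ε')N`. [folklore] -/
theorem stub_truncationCompactness_of_maxFormApproximation :
    (∀ v : ℝ → ℝ≥0∞, IsRepulsiveFiniteRange v → ∀ (N : ℕ) (L : ℝ) (hL : 0 < L),
      ∀ η : Lp ℂ 2 (volume : Measure (UnitAddTorus (Fin N × Fin 3))), ‖η‖ = 1 →
        (∀ (σ : Equiv.Perm (Fin N)) (n : Fin N × Fin 3 → ℤ),
          ⟪(mFourierLp 2 (fun p : Fin N × Fin 3 => n (σ p.1, p.2)) :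
              Lp ℂ 2 (volume : Measure (UnitAddTorus (Fin N × Fin 3)))), η⟫_ℂ =
            ⟪(mFourierLp 2 n : Lp ℂ 2 (volume : Measure (UnitAddTorus (Fin N × Fin 3)))), η⟫_ℂ) →
        (∑' n : Fin N × Fin 3 → ℤ, ENNReal.ofReal (∑ p, (2 * Real.pi * (n p : ℝ) / L) ^ 2) *
              (‖⟪(mFourierLp 2 n : Lp ℂ 2 (volume : Measure (UnitAddTorus (Fin N × Fin 3)))), η⟫_ℂ‖₊ :
                ℝ≥0∞) ^ 2 +
            ∫⁻ t, periodicInteraction v L (fromUnitTorusN L t) *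
              (‖(η : UnitAddTorus (Fin N × Fin 3) → ℂ) t‖₊ : ℝ≥0∞) ^ 2) ≠ ⊤ →
        ∀ ε : ℝ, 0 < ε → ∃ Φ : PeriodicTrialState N L,
          periodicEnergy v Φ ≤
            (∑' n : Fin N × Fin 3 → ℤ, ENNReal.ofReal (∑ p, (2 * Real.pi * (n p : ℝ) / L) ^ 2) *
                (‖⟪(mFourierLp 2 n : Lp ℂ 2 (volume : Measure (UnitAddTorus (Fin N × Fin 3)))), η⟫_ℂ‖₊ :
                  ℝ≥0∞) ^ 2 +
              ∫⁻ t, periodicInteraction v L (fromUnitTorusN L t) *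
                (‖(η : UnitAddTorus (Fin N × Fin 3) → ℂ) t‖₊ : ℝ≥0∞) ^ 2) + ENNReal.ofReal ε ∧
          ‖formEmbed hL measurable_zeroProfile (lintegral_periodicInteraction_zero_ne_top N L)
              ⟨graphEmbed hL measurable_zeroProfile (lintegral_periodicInteraction_zero_ne_top N L)
                ⟨Φ.ψ, Φ.mem_periodicCore⟩, graphEmbed_mem_formDomain _ _ _ _⟩ - η‖ ≤ ε) →
    ∀ v : ℝ → ℝ≥0∞, IsRepulsiveFiniteRange v → ∀ (N : ℕ) (L : ℝ), 0 < L →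
      periodicGroundStateEnergy v N L ≠ ⊤ →
      ∀ c : ℝ,
        (∀ n : ℕ, ∃ Ψ : PeriodicTrialState N L,
            periodicEnergy (fun r => min (v r) (n : ℝ≥0∞)) Ψ =
              periodicGroundStateEnergy (fun r => min (v r) (n : ℝ≥0∞)) N L ∧
            periodicEnergy (fun r => min (v r) (n : ℝ≥0∞)) Ψ ≠ ⊤ ∧
            (∀ X, Ψ.ψ X = (‖Ψ.ψ X‖ : ℂ)) ∧ (∀ X, Ψ.ψ X ≠ 0) ∧
            ENNReal.ofReal (c * N) ≤ condensateOccupation N L Ψ.ψ) →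
        ∀ ε' : ℝ, 0 < ε' → ∀ δ' : ℝ≥0∞, 0 < δ' → ∃ Φ : PeriodicTrialState N L,
          periodicEnergy v Φ ≤ periodicGroundStateEnergy v N L + δ' ∧
          ENNReal.ofReal ((c - ε') * N) ≤ condensateOccupation N L Φ.ψ := by
  intro hcore v hv N L hL hE c hmin ε' hε' δ' hδ'
  choose Ψ hΨ using hmin
  -- the truncation minimisers have truncated energies `≤ E₀(v)`
  have hB : ∀ n, periodicEnergy (truncPotential v n) (Ψ n) ≤ periodicGroundStateEnergy v N L := fun n =>
    (le_of_eq (hΨ n).1).trans (periodicGroundStateEnergy_truncPotential_le' v n N L)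
  obtain ⟨η, φ, -, hconv, hη1, hηsymm, hQ⟩ := exists_limitProfile_of_seq hv.1 hL hE Ψ hB
  -- the scale `ε = min (min δ' 1).toReal (ε'/4)`
  set ε : ℝ := min (min δ' 1).toReal (ε' / 4) with hεdef
  have hδ1_ne_top : min δ' 1 ≠ ⊤ := ne_top_of_le_ne_top ENNReal.one_ne_top (min_le_right _ _)
  have hδ1_pos : 0 < (min δ' 1).toReal := ENNReal.toReal_pos (lt_min hδ' zero_lt_one).ne' hδ1_ne_top
  have hε : 0 < ε := lt_min hδ1_pos (by positivity)
  have hεδ : ENNReal.ofReal ε ≤ δ' :=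
    calc ENNReal.ofReal ε ≤ ENNReal.ofReal (min δ' 1).toReal := ENNReal.ofReal_le_ofReal (min_le_left _ _)
      _ = min δ' 1 := ENNReal.ofReal_toReal hδ1_ne_top
      _ ≤ δ' := min_le_left _ _
  have hε4 : 4 * ε ≤ ε' := by linarith [min_le_right (min δ' 1).toReal (ε' / 4)]
  -- the approximant of the limit profile
  obtain ⟨Φ, hΦE, hΦdist⟩ := hcore v hv N L hL η hη1 hηsymm (ne_top_of_le_ne_top hE hQ) ε hε
  refine ⟨Φ, (hΦE.trans (add_le_add hQ le_rfl)).trans (add_le_add le_rfl hεδ), ?_⟩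
  -- an index of the subsequence `ε`-close to `η`
  obtain ⟨I, hI⟩ := NormedAddCommGroup.tendsto_atTop.1 hconv ε hε
  have hIε := hI I le_rfl
  -- `‖Ψ_{φ I} - Φ‖_{L²(cell)} ≤ 2ε`
  have hdist : ‖formEmbed hL measurable_zeroProfile (lintegral_periodicInteraction_zero_ne_top N L)
        ⟨graphEmbed hL measurable_zeroProfile (lintegral_periodicInteraction_zero_ne_top N L)
          ⟨(Ψ (φ I)).ψ, (Ψ (φ I)).mem_periodicCore⟩, graphEmbed_mem_formDomain _ _ _ _⟩ -
      formEmbed hL measurable_zeroProfile (lintegral_periodicInteraction_zero_ne_top N L)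
        ⟨graphEmbed hL measurable_zeroProfile (lintegral_periodicInteraction_zero_ne_top N L)
          ⟨Φ.ψ, Φ.mem_periodicCore⟩, graphEmbed_mem_formDomain _ _ _ _⟩‖ ≤ 2 * ε := by
    refine (norm_sub_le_norm_sub_add_norm_sub _ η _).trans ?_
    rw [norm_sub_rev η]
    linarith [hIε.le, hΦdist]
  have hlint : (∫⁻ X in cellN N L, (‖(Ψ (φ I)).ψ X - Φ.ψ X‖₊ : ℝ≥0∞) ^ 2).toReal ≤ (2 * ε) ^ 2 := by
    rw [← norm_formEmbed_sub_sq_trialState hL (Ψ (φ I)) Φ]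
    exact pow_le_pow_left₀ (norm_nonneg _) hdist 2
  have hcont : Continuous fun X => (Ψ (φ I)).ψ X - Φ.ψ X :=
    (Ψ (φ I)).contDiff.continuous.sub Φ.contDiff.continuous
  have hint : ∫ X in cellN N L, ‖(Ψ (φ I)).ψ X - Φ.ψ X‖ ^ 2 ≤ (2 * ε) ^ 2 := by
    rwa [lintegral_cellN_nnnorm_sq_eq_ofReal L hcont,
      ENNReal.toReal_ofReal (integral_nonneg fun X => by positivity)] at hlint
  -- Lipschitz continuity of `n₀`
  have hocc := condensateOccupation_le_add_of_sq_dist_le hL (Ψ (φ I)).contDiff.continuous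
    Φ.contDiff.continuous (Ψ (φ I)).norm_eq.le Φ.norm_eq.le hint
  rw [Real.sqrt_sq (by positivity)] at hocc
  have hchain : ENNReal.ofReal (c * N) ≤ condensateOccupation N L Φ.ψ + ENNReal.ofReal (4 * ε * N) := by
    refine ((hΨ (φ I)).2.2.2.2.trans hocc).trans (le_of_eq ?_)
    congr 2
    ring
  have h4 := ofReal_sub_mul_le_of_le_add (by positivity : (0 : ℝ) ≤ 4 * ε) N hchain
  refine (ENNReal.ofReal_le_ofReal ?_).trans h4
  have hN : (0 : ℝ) ≤ N := Nat.cast_nonneg N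
  nlinarith

end Reduction

end Summit.AtomisticToContinuum.BoseEinsteinCondensation.Cruxes.HardCoreExtension.ThirdLawCurrentFloor

end
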